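import Summits.FinalStateConjecture.FinalStateConjecture.Statement

/-!
# Solo (blind) — the order-theoretic core of Case B of the bag-of-gold analysis

In the analysis of the bag-of-gold candidate counterexample to the typed final state conjecture
(`paper/bag-of-gold-note.md`, Note B, §B5.7 and §B13) the decisive topological step is the
following.  A late leaf `Σ_t` of a putative Kerr final-state decomposition is cut down to the
bag region, lifted to the universal cover and written, in a timelike-fibred product chart
`ℝ × Ỹ`, as the graph `σ = F(y)` of a continuous function on a connected space `Ỹ` on which the
deck group `Γ = π₁` acts; embeddedness and achronality of the leaf downstairs say exactly that the
graph of `F` is disjoint from each of its non-trivial deck translates, i.e.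
`F y ≠ F (g • y)` for all `y` and all `g ≠ 1` (`soloBlind_disjoint_graph_translate_iff`).

This file isolates the purely order-theoretic consequence, with no geometry left in it:

* `soloBlind_orderLemma` — two continuous real functions on a preconnected space with disjoint
  graphs are strictly ordered everywhere, one way or the other (the set `{F < G}` is clopen).
* `soloBlindRaising Γ F = {g | ∀ y, F y < F (g • y)}` is then a POSITIVE CONE of `Γ`:
  it omits `1`, is closed under multiplication, contains no element together with its inverse,
  and — by the order lemma applied to `F` and `F ∘ (g • ·)` — contains `g` or `g⁻¹` for every
  `g ≠ 1` (`soloBlind_mem_raising_or_inv_mem`).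
* Consequently `Γ` carries a left-invariant strict total order
  (`soloBlind_exists_leftInvariantOrder_of_disjoint_translates`) and is torsion-free
  (`soloBlind_pow_ne_one_of_disjoint_translates`).

ONE `Γ`-disjoint graph suffices; the earlier write-up (§B5.7, Steps 2–4) used the whole family of
late leaves and is thereby simplified (§B13).  In the application `Γ` is the fundamental group of
the Weeks manifold, which is finite-index-free of such orders: it is not left-orderable
(D. Calegari, N. Dunfield, Invent. Math. 152 (2003) 149–204, Table/§9, the Weeks manifold
`m003(-3,1)`), so no such leaf exists.  That citation is context only — nothing in this file
depends on it; the theorems below are elementary point-set topology and group theory over Mathlib.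
-/

noncomputable section

open Set

set_option linter.dupNamespace false

namespace Summit.FinalStateConjecture.FinalStateConjecture.Theorems

section OrderLemma

variable {Y : Type*} [TopologicalSpace Y] [PreconnectedSpace Y]

/-- ORDER LEMMA.  Two continuous real functions on a preconnected space whose graphs are disjoint
are strictly ordered everywhere, one way or the other: `{y | F y < G y}` is open, and its
complement `{y | G y < F y}` (disjointness) is open too. -/
theorem soloBlind_orderLemma {F G : Y → ℝ} (hF : Continuous F) (hG : Continuous G)
    (h : ∀ y, F y ≠ G y) : (∀ y, F y < G y) ∨ (∀ y, G y < F y) := by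
  have hcompl : {y | F y < G y}ᶜ = {y | G y < F y} := by
    ext y
    simp only [mem_compl_iff, mem_setOf_eq, not_lt]
    exact ⟨fun hle => lt_of_le_of_ne hle (h y).symm, fun hlt => hlt.le⟩
  have hclopen : IsClopen {y | F y < G y} := by
    refine ⟨?_, isOpen_lt hF hG⟩
    rw [← isOpen_compl_iff, hcompl]
    exact isOpen_lt hG hF
  rcases isClopen_iff.mp hclopen with h0 | h1
  · refine Or.inr fun y => ?_
    have hy : y ∉ {y | F y < G y} := by rw [h0]; exact fun h => h
    exact lt_of_le_of_ne (not_lt.mp hy) (h y).symm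
  · refine Or.inl fun y => ?_
    have hy : y ∈ {y | F y < G y} := by rw [h1]; exact mem_univ y
    exact hy

end OrderLemma

section PositiveCone

variable {Γ : Type*} [Group Γ] {Y : Type*} [MulAction Γ Y]

variable (Γ) in
/-- The RAISING SET of a real function `F` under a group action: the group elements `g` whose
translate `y ↦ F (g • y)` lies strictly above `F` everywhere.  Under the hypotheses of
`soloBlind_mem_raising_or_inv_mem` it is a positive cone of `Γ`. -/
def soloBlindRaising (F : Y → ℝ) : Set Γ := {g : Γ | ∀ y, F y < F (g • y)}

/-- Membership in the raising set, unfolded. -/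
theorem soloBlind_mem_raising_iff {F : Y → ℝ} {g : Γ} :
    g ∈ soloBlindRaising Γ F ↔ ∀ y, F y < F (g • y) := Iff.rfl

/-- The raising set omits the identity (if the space is nonempty). -/
theorem soloBlind_one_not_mem_raising [Nonempty Y] (F : Y → ℝ) :
    (1 : Γ) ∉ soloBlindRaising Γ F := by
  intro h
  obtain ⟨y⟩ := ‹Nonempty Y›
  exact lt_irrefl (F y) (by simpa only [one_smul] using h y)

/-- The raising set is closed under multiplication. -/
theorem soloBlind_mul_mem_raising {F : Y → ℝ} {g h : Γ} (hg : g ∈ soloBlindRaising Γ F)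
    (hh : h ∈ soloBlindRaising Γ F) : g * h ∈ soloBlindRaising Γ F := by
  intro y
  calc F y < F (h • y) := hh y
    _ < F (g • h • y) := hg (h • y)
    _ = F ((g * h) • y) := by rw [mul_smul]

/-- Powers of a raising element are raising. -/
theorem soloBlind_pow_mem_raising {F : Y → ℝ} {g : Γ} (hg : g ∈ soloBlindRaising Γ F) :
    ∀ n : ℕ, 0 < n → g ^ n ∈ soloBlindRaising Γ F := by
  intro n hn
  induction n with
  | zero => exact absurd hn (lt_irrefl 0)
  | succ k ih =>
    rcases Nat.eq_zero_or_pos k with hk | hk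
    · subst hk; simpa using hg
    · rw [pow_succ]
      exact soloBlind_mul_mem_raising (ih hk) hg

/-- No element lies in the raising set together with its inverse. -/
theorem soloBlind_inv_not_mem_raising [Nonempty Y] {F : Y → ℝ} {g : Γ}
    (hg : g ∈ soloBlindRaising Γ F) : g⁻¹ ∉ soloBlindRaising Γ F := by
  intro hinv
  have h1 : g⁻¹ * g ∈ soloBlindRaising Γ F := soloBlind_mul_mem_raising hinv hg
  rw [inv_mul_cancel] at h1
  exact soloBlind_one_not_mem_raising F h1

variable [TopologicalSpace Y] [PreconnectedSpace Y] [ContinuousConstSMul Γ Y]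

/-- TOTALITY.  If `F` is continuous, the action is by homeomorphisms, the space is preconnected
and the graph of `F` is disjoint from its `g`-translate, then `g` or `g⁻¹` is raising. -/
theorem soloBlind_mem_raising_or_inv_mem {F : Y → ℝ} (hF : Continuous F) {g : Γ}
    (hdisj : ∀ y, F y ≠ F (g • y)) :
    g ∈ soloBlindRaising Γ F ∨ g⁻¹ ∈ soloBlindRaising Γ F := by
  have hG : Continuous fun y => F (g • y) := hF.comp (continuous_const_smul g)
  rcases soloBlind_orderLemma hF hG hdisj with h | h
  · exact Or.inl h
  · refine Or.inr fun y => ?_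
    have hy := h (g⁻¹ • y)
    rwa [smul_inv_smul] at hy

/-- TRICHOTOMY for the raising set under `Γ`-disjointness of the graph. -/
theorem soloBlind_raising_trichotomy {F : Y → ℝ} (hF : Continuous F)
    (hdisj : ∀ g : Γ, g ≠ 1 → ∀ y, F y ≠ F (g • y)) (g : Γ) :
    g ∈ soloBlindRaising Γ F ∨ g = 1 ∨ g⁻¹ ∈ soloBlindRaising Γ F := by
  by_cases hg : g = 1
  · exact Or.inr (Or.inl hg)
  · rcases soloBlind_mem_raising_or_inv_mem hF (hdisj g hg) with h | h
    · exact Or.inl h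
    · exact Or.inr (Or.inr h)

/-- TORSION-FREENESS.  A group acting by homeomorphisms on a nonempty preconnected space that
admits a continuous real function whose graph is disjoint from all its non-trivial translates is
torsion-free. -/
theorem soloBlind_pow_ne_one_of_disjoint_translates [Nonempty Y] {F : Y → ℝ} (hF : Continuous F)
    (hdisj : ∀ g : Γ, g ≠ 1 → ∀ y, F y ≠ F (g • y)) {g : Γ} (hg : g ≠ 1) {n : ℕ} (hn : 0 < n) :
    g ^ n ≠ 1 := by
  intro hgn
  rcases soloBlind_mem_raising_or_inv_mem hF (hdisj g hg) with h | h
  · exact soloBlind_one_not_mem_raising (Γ := Γ) F (hgn ▸ soloBlind_pow_mem_raising h n hn)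
  · have h' : (g⁻¹) ^ n = 1 := by rw [inv_pow, hgn, inv_one]
    exact soloBlind_one_not_mem_raising (Γ := Γ) F (h' ▸ soloBlind_pow_mem_raising h n hn)

/-- LEFT-INVARIANT ORDER.  Under the same hypotheses `Γ` carries a left-invariant strict total
order, namely `a < b :↔ a⁻¹ * b ∈ soloBlindRaising Γ F`.  (In the application, `Γ = π₁` of the
Weeks manifold admits no such order, which is the contradiction closing Case B of Note B §B5.7.) -/
theorem soloBlind_exists_leftInvariantOrder_of_disjoint_translates [Nonempty Y] {F : Y → ℝ}
    (hF : Continuous F) (hdisj : ∀ g : Γ, g ≠ 1 → ∀ y, F y ≠ F (g • y)) :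
    ∃ lt : Γ → Γ → Prop,
      (∀ a, ¬ lt a a) ∧
      (∀ a b c, lt a b → lt b c → lt a c) ∧
      (∀ a b, lt a b ∨ a = b ∨ lt b a) ∧
      (∀ c a b, lt a b → lt (c * a) (c * b)) ∧
      (∀ a b, lt a b ↔ a⁻¹ * b ∈ soloBlindRaising Γ F) := by
  refine ⟨fun a b => a⁻¹ * b ∈ soloBlindRaising Γ F, ?_, ?_, ?_, ?_, fun a b => Iff.rfl⟩
  · intro a h
    rw [inv_mul_cancel] at h
    exact soloBlind_one_not_mem_raising F h
  · intro a b c hab hbc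
    have h := soloBlind_mul_mem_raising hab hbc
    simpa only [mul_assoc, mul_inv_cancel_left] using h
  · intro a b
    rcases soloBlind_raising_trichotomy hF hdisj (a⁻¹ * b) with h | h | h
    · exact Or.inl h
    · exact Or.inr (Or.inl (inv_mul_eq_one.mp h))
    · refine Or.inr (Or.inr ?_)
      simpa only [mul_inv_rev, inv_inv] using h
  · intro c a b hab
    simpa only [mul_inv_rev, mul_assoc, inv_mul_cancel_left] using hab

omit [TopologicalSpace Y] [PreconnectedSpace Y] [ContinuousConstSMul Γ Y] in
/-- POINTWISE FORM of the order.  `a⁻¹ * b` is raising iff the `a⁻¹`-translate of `F` lies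
strictly above the `b⁻¹`-translate: `∀ y, F (b⁻¹ • y) < F (a⁻¹ • y)`. -/
theorem soloBlind_inv_mul_mem_raising_iff {F : Y → ℝ} (a b : Γ) :
    a⁻¹ * b ∈ soloBlindRaising Γ F ↔ ∀ y, F (b⁻¹ • y) < F (a⁻¹ • y) := by
  constructor
  · intro h y
    have hy := h (b⁻¹ • y)
    rwa [mul_smul, smul_inv_smul] at hy
  · intro h y
    have hy := h (b • y)
    rwa [inv_smul_smul, ← mul_smul] at hy

end PositiveCone

section Graphs

variable {Γ : Type*} [Group Γ] {Y : Type*} [MulAction Γ Y]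

/-- GRAPH FORM of the hypothesis.  In the product `ℝ × Y` with the deck action on the second
factor, the graph `{(F y, y)}` of `F` is disjoint from its `g`-translate `{(F y, g • y)}` iff
`F y ≠ F (g • y)` for all `y` — the form in which embeddedness plus achronality of a leaf enters
in Note B §B5.7. -/
theorem soloBlind_disjoint_graph_translate_iff (F : Y → ℝ) (g : Γ) :
    Disjoint (range fun y : Y => (F y, y))
      ((fun p : ℝ × Y => (p.1, g • p.2)) '' range fun y : Y => (F y, y)) ↔
      ∀ y, F y ≠ F (g • y) := by
  constructor
  · intro h y hy
    refine (Set.disjoint_left.mp h) (mem_range_self (g • y)) ?_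
    exact ⟨(F y, y), mem_range_self y, by simp [hy]⟩
  · intro h
    refine Set.disjoint_left.mpr ?_
    rintro _ ⟨z, rfl⟩ ⟨p, ⟨y, rfl⟩, hp⟩
    have hp' : F y = F z ∧ g • y = z := by simpa using hp
    obtain ⟨hF, hz⟩ := hp'
    exact h y (by rw [hz]; exact hF)

end Graphs

end Summit.FinalStateConjecture.FinalStateConjecture.Theorems
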